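import Summits.QuantumFields.YangMills.Theorems.BalabanUVNodesN07SymNearRowsTop
import Summits.QuantumFields.YangMills.Theorems.BalabanUVNodesN07SymNearRowsDent
import Summits.QuantumFields.YangMills.Theorems.BalabanUVNodesN07DbarNearRowsQA
import HarnessLib

/-!
# N07 [B11] (= [15] = [Balaban1985Variational]) Sect. F — MODULE 98′ (plan g93 A3⁵ ∕ director №311a (β), chart side (III)-4): **(c′) — THE NEAR ROWS OF THE BLOCK AVERAGES
# `Q_{j(c)}A(c)` ON MODULE 77b's NEAR CLASS, AT THE RECORD, UNDER THE φ-b₂ PREMISE** — MODULE 98 (`…N07DbarNearRowsQA`) re-cut: for every constraint bond `c` of print's family `D″` in the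
# near class «top, or both end blocks in `□_{j(c)+1}`» at a meeting, print-margin-clean datum under `NrmSymPhiOfRecord … ψ`:
# `‖Q_{j(c)}A(c)‖ ≤ L·(2·(X₀′·δ_j + Ω·(1 + X₀′·δ_j)) + 64·60800·ℓ²·(κ·ε_j·L)²)` — δ-LINEAR PLUS the ε²-type terms `Ω` (the φ∕ψ frame and normalisation costs of 96′∕97′) and UST's
# second-order remainder; `X₀′ = (d−1)·crad·(1+2C_L) + 14·t_c + 2(d+1)(L−1)·(14⌊d(L−1)∕2⌋+1)·(d−1)(L−1)`, `Ω = ω + ω + ω·ω`, `ω = φ + 6ψ + φ·6ψ`, `φ = 100·(240ℓ²κε_jL)²`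

Cell `pub-ymgap`, seat `pub-ymgap-dag-n07-e` g30 (FAN-OUT §N07 row s3; LANE OWNER of the K0 road chart side).  `--kind proof --supports stmt-QuantumFields-20541 --as helper` (K0⁷);
count-neutral; THEOREMS ONLY (0 `def`).  [15] = [Balaban1985Variational]; [3] = [Balaban1985Averaging]; [6] = [Balaban1985RegularSpaces]; [4] = [Balaban1984PropagatorsII];
[III] = [Balaban1988Convergent]; [I] = [Balaban1987RG1].

WHY.  89⁗'s (c′) letter `hQnear` (at `NrmSymPhiOfRecord … ψ`) asks `‖Q_{j(c)}A(c)‖ ≤ β₁ ε δ j` on the near class with a `β₁` the knit's budget row absorbs in `C·δ_j + θ·ε_j + Q·ε_j²`.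
MODULE 79 splits the near class into top bonds (96′ `norm_dbar_sub_one_top_le_symPhi`) and level-(j−1) dent pairs (97′ `norm_dbar_sub_one_dent_le_symPhi`); both rows read
`r + Ω(1+r)` with `r ≤ X₀′·δ_j` (`δ_{j−1} ≤ 2δ_j`, MODULE 98 `dent_row_le_linear`); under the ONE range guard `X₀′·a₁ + 2Ω ≤ ½` the logarithm ([3] (26)) is within `2·(X₀′δ_j + Ω(1+X₀′δ_j))`,
and UST's second-order row (MODULE 94 `norm_bondAvgIter_le_of_dbar_reads`) with the weight `1∕(η·Lˡ) ≤ L` (MODULE 98 `div_weight_le`) gives the header's row.  The accumulated frames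
`V` of 96′∕97′ are instantiated at the recursion's own family.

WHAT IS PROVED (sorry-free; no `def`; axioms standard).  §1 `row_mono` (numeric).  §2 ★★★ `norm_bondAvgIter_le_of_near_symPhi (F N)` — the header's row for EVERY `c : BondIdx D″` in the
near class; hypotheses = 96′∕97′'s (with `Adm22 D″ R M_b`, the φ-guards, the sym within-block guard, `0 ≤ ψ ≤ 1∕32`) + the range guard + the UST budget `243200·ℓ²·(κ·ε·L) ≤ 1`.
HONEST SCOPE: by-name composition; `NrmSymPhiOfRecord` is a displayed premise row (CONDITIONAL, N05's (B′) road); (T1)∕(T2) are the S3 door's rows; the guards are the K0 assembler's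
numerics; nothing of [15]∕[6]∕[3]∕[III] ANALYSIS asserted beyond the cited lemmas; (c′) closes at MODULE 99′ (the binder adapter); K0⁷ NOT closed; N07 NOT discharged; counts unmoved; one
finite 𝕋⁴ programme at fixed ε — the route closes the conditional finite-𝕋⁴ rung `BalabanLadder.UV` ONLY; the YM mass gap (Clay) is NOT proved by any of this; nothing continuum ∕ ℝ⁴ ∕
OS.  No `def`, no `instance`, no `notation`, no `sorry`.

References: [15] (152)–(157) pp. 301–302, (160) p. 303, (144) p. 300, (147)–(150) p. 301; [3] (26) p. 22, (78)–(81) p. 30, (125)–(127) p. 36, Prop. 4 (134)–(135) p. 38; [6] Lemma 1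
(1.25) p. 79, p. 98, (1.131) p. 99; [4] (2.1)–(2.3) p. 224, [Balaban1984PropagatorsI] (1.18) p. 20; [III] (2.10)–(2.13) pp. 255–257; [I] (0.4), (0.6), (0.11) p. 253.
-/

set_option autoImplicit false

noncomputable section

open scoped BigOperators Matrix.Norms.L2Operator

namespace Summit.QuantumFields.YangMills.BalabanUVNodes.N07SymNearRowsQAPhi

open Literature.MathematicalPhysics.QuantumFieldTheory.Balaban1983to89
open Literature.MathematicalPhysics.QuantumFieldTheory.Balaban1983to89.Node00
open Literature.MathematicalPhysics.QuantumFieldTheory.Balaban1983to89.B15DeterminingSets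
open T4Continuum (T4Family)
open T4AxialGaugeSmallField (castSite castSite_add_e)
open B15Eq112TorusCover (cover)
open B14DomainGeom (Pt Within)
open B7Prop1Local (InBox)
open B7Prop1Explicit (e e_apply)
open B8Eq131Cubes (box cube sqLo sqHi tLo tHi crad)
open B5Eq118OneStroke (iterBlockOf iterBlockOf_succ)
open B6SectADomainsV1 (Domains)
open B6SectAOperatorsV1 (BondIdx)
open B10Eq27TorusAxialLog (unitsField toUField)
open B12RegularSpaces111 (gaugeU expI)
open GaugeField (gaugeAct)
open ExpMeanLog (expMeanLogSU deltaSU)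
open FederbushMean (federbushSU deltaFed)
open Summit.QuantumFields.YangMills.Theorems.FlatCubeOpsText (Adm22)
open Summit.QuantumFields.YangMills.Theorems.Prop8Chart (expCfg)
open Summit.QuantumFields.YangMills.Theorems.Prop8ChartDoubleBar (vframeU dbarIterU)
open Summit.QuantumFields.YangMills.BalabanUVNodes.N07Thm4RecordStructureSym152Phi (NrmSymPhiOfRecord)
open Summit.QuantumFields.YangMills.BalabanUVNodes.N07SymNearRowsTopPhi (norm_dbar_sub_one_top_le_symPhi)
open Summit.QuantumFields.YangMills.BalabanUVNodes.N07SymNearRowsDentPhi (norm_dbar_sub_one_dent_le_symPhi)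
open Summit.QuantumFields.YangMills.BalabanUVNodes.N07DbarNearRowsQA (dent_row_le_linear div_weight_le)
open Summit.QuantumFields.YangMills.BalabanUVNodes.N07DbarNearBondReading (norm_mlog_le_two_mul_of_le norm_bondAvgIter_le_of_dbar_reads)
open Summit.QuantumFields.YangMills.BalabanUVNodes.N07CubeTowerInsideRecordBelowTop (near_cases_meet_both)
open Summit.QuantumFields.YangMills.BalabanUVNodes.N07FarRowsOfTowerLetters (exists_collar_labels_of_lamBond_meet)
open Summit.QuantumFields.YangMills.BalabanUVNodes.N07DbarDictionaryTransfer (landau_reads_of_tower)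
open Summit.QuantumFields.YangMills.BalabanUVNodes.N07NearRowsAtRecordWideClass (Icc_collar_of_inBox Icc_collar_add_e_of_inBox)
open LatticeFieldCalculus (bondAvgIter)
open MatrixLog (mlog)

/-! ## §1  Numeric -/

/-- Monotonicity of the row `r + Ω(1+r)` in `r` for `Ω ≥ 0`. [folklore] -/
theorem row_mono {r r₁ Ω : ℝ} (h : r ≤ r₁) (hΩ : 0 ≤ Ω) : r + Ω * (1 + r) ≤ r₁ + Ω * (1 + r₁) := by
  nlinarith [mul_le_mul_of_nonneg_left h hΩ]

/-! ## §2  (c′): the near rows of `Q_{j(c)} A (c)` under the φ-b₂ premise -/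

section Record

variable (F : T4Family) (N : ℕ) [NeZero N]

set_option maxHeartbeats 800000 in
/-- ★★★ **(c′) — THE NEAR ROWS OF THE BLOCK AVERAGES AT THE RECORD UNDER THE φ-b₂ PREMISE** (statement in the header): for every cell `c` of `D″` at a meeting, print-margin-clean
datum `(j, idx)` in MODULE 77b's near class, `‖Q_{j(c)}A(c)‖ ≤ L·(2·(X₀′·δ_j + Ω·(1 + X₀′·δ_j)) + 64·60800·ℓ²·(κ·ε·L)²)`.
[cite: Balaban1985Variational, (152)–(157) pp.301–302, (160) p.303, (147)–(150) p.301; Balaban1985Averaging, (26) p.22, (78)–(81) p.30, (125)–(127) p.36, Prop. 4 (134)–(135) p.38; Balaban1985RegularSpaces, Lemma 1 (1.25) p.79, p.98, (1.131) p.99; Balaban1984PropagatorsII, (2.1)–(2.3) p.224; Balaban1987RG1, (0.6), (0.11) p.253] -/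
theorem norm_bondAvgIter_le_of_near_symPhi {ν : Stage7Numerics} {M : ℕ} {g : ℕ → ℝ} {K k : ℕ} (s : SeqOfRecord F ν M g K k)
    (hsep : Sect2.SeqSeparated ν.M₁ s) (hkK : k ≤ (F.P K).m + (F.P K).K)
    (hgrid : ∀ j : ℕ, 1 ≤ j → j ≤ k → dCubeSide (F.P K).L M (RkOfRecord (F.P K).L ν.r (g j)) j ∣ (F.P K).sitesPerDir 0)
    {Mc ρ : ℕ} (hMc : 1 ≤ Mc) (hρ : 1 ≤ ρ) (hLρ : (F.P K).L ≤ ρ) (hfloor : (11 * (F.P K).d + 4 * ρ + Mc) * (F.P K).L + 3 ≤ ν.M₁)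
    {δ : ℕ → ℝ} {a₁ : ℝ} (hδ : ∀ n, n ≤ k → 0 < δ n ∧ δ n ≤ a₁) (hcompδ : ∀ n, n < k → δ n ≤ 2 * δ (n + 1))
    (hguard : (((((F.P K).d + 2) * (F.P K).L : ℕ) : ℝ) ^ 2 / 4) * ((4 * (((((F.P K).d - 1 : ℕ) : ℝ)) * ((2 * (F.P K).L - 1 : ℕ) : ℝ)) + 1) * a₁) < deltaSU (Fin N))
    (hguardF : 2 * ((((F.P K).d * (((F.P K).L - 1) / 2) : ℕ) : ℝ) * (((((F.P K).d - 1 : ℕ) : ℝ) * (((F.P K).L - 1 : ℕ) : ℝ)) * a₁)) < (federbushSU (n := Fin N)).δ)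
    (W : MSField (F.P K) (SU N)) (h7 : Sect2.DataSmall7PTop (avOfRecord F N K) s.Ω (suppDomOfRecord F ν K s.Ω) k δ W)
    (U : GaugeField (F.P K) 0 (SU N)) (hfib : AgreeOn (genSet s.Ω k) (avgFamily (avOfRecord F N K) U) W)
    {j : ℕ} (hj1 : 1 ≤ j) (hjk : j ≤ k) (hjK : j + 1 ≤ (F.P K).m + (F.P K).K) (idx : Pt (F.P K).d)
    (hmeet : ∃ x ∈ box (F.P K).L (cornerP (F.P K) Mc ρ idx) (sideP (F.P K) Mc ρ) j, ∃ y : Pt (F.P K).d, cover (F.P K) y ∈ s.Ω j ∧ Within ((3 : ℕ) : ℤ) x y)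
    (hclean : j = k ∨ ∀ z ∈ box (F.P K).L (cornerP (F.P K) Mc ρ idx - ((2 * ρ : ℕ) : Pt (F.P K).d)) (sideP (F.P K) Mc ρ + 2 * (2 * ρ)) j,
      cover (F.P K) z ∉ s.Ω (j + 1))
    {n₀ : ℕ} (hn : ∀ κ, (tHi (cornerP (F.P K) Mc ρ idx) (sideP (F.P K) Mc ρ) ρ) κ ≤ (tLo (cornerP (F.P K) Mc ρ idx) ρ) κ + n₀) (hnN : n₀ + 1 < (F.P K).sitesPerDir j)
    (u : GaugeTransf (F.P K) 0 (SU N)) (A : PBond (F.P K) 0 → MatA N) {κ ε' : ℝ} (hκ : 0 ≤ κ) (hε' : 0 ≤ ε')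
    (hT1 : ∀ b ∈ (Sect2.regionOfSet (F.P K) (cover (F.P K) '' cube (F.P K).L (cornerP (F.P K) Mc ρ idx) (sideP (F.P K) Mc ρ) ρ j 0)).bonds,
      gaugeU (fun x => ιSU N (u x)) (fun b' => ιSU N (U b')) b = expI ((F.P K).eta j) (A b))
    (hT2 : ∀ j', j' ≤ j → ∀ b ∈ (Sect2.regionOfSet (F.P K) (cover (F.P K) '' cube (F.P K).L (cornerP (F.P K) Mc ρ idx) (sideP (F.P K) Mc ρ) ρ j j')).bonds,
      ‖A b‖ < κ * ε' * ((F.P K).L : ℝ) ^ (j - j'))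
    (hbud : 243200 * ((((F.P K).d + 2) * (F.P K).L : ℕ) : ℝ) ^ 2 * (κ * ε' * ((F.P K).L : ℝ)) ≤ 1)
    (hgd : 60 * ((((F.P K).d + 2) * (F.P K).L : ℕ) : ℝ) ^ 2 * (κ * ε' * ((F.P K).L : ℝ)) < deltaSU (Fin N))
    (hσF : 5760 * ((((F.P K).d + 2) * (F.P K).L : ℕ) : ℝ) ^ 2 * (κ * ε' * ((F.P K).L : ℝ)) < deltaFed (Fin N))
    (hσS : 2880 * ((((F.P K).d + 2) * (F.P K).L : ℕ) : ℝ) ^ 2 * (κ * ε' * ((F.P K).L : ℝ)) < deltaSU (Fin N))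
    (hσ4 : 240 * ((((F.P K).d + 2) * (F.P K).L : ℕ) : ℝ) ^ 2 * (κ * ε' * ((F.P K).L : ℝ)) ≤ 1 / 10000)
    (hk : j ≤ (F.P K).m + (F.P K).K) {ψ : ℝ} (hψ0 : 0 ≤ ψ) (hψ : ψ ≤ 1 / 32) (hN : NrmSymPhiOfRecord F N Mc ρ ψ ν M g K k s U j idx u A) {R Mb : ℕ}
    (hAdm : Adm22 (domainsMeet (cubeDomains (F.P K) (cornerP (F.P K) Mc ρ idx) (sideP (F.P K) Mc ρ) ρ j hk) (domainsOfSeq s.Ω j hk)) R Mb)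
    (hRM : 2 * (F.P K).L ≤ R * Mb + 1)
    -- the ONE range guard: `X₀′·a₁ + 2Ω ≤ ½`
    (hX : ((((F.P K).d - 1 : ℕ) : ℝ) * ((crad (sideP (F.P K) Mc ρ) ρ : ℕ) : ℝ) * (1 + 2 * ((((F.P K).L : ℝ) ^ 2 + 6 * ((((F.P K).d + 2) * (F.P K).L : ℕ) : ℝ) ^ 2) * (4 * ((((F.P K).d - 1 : ℕ) : ℝ) * ((2 * (F.P K).L - 1 : ℕ) : ℝ)) + 1))) + 14 * (((((F.P K).d + 2) * (F.P K).L : ℕ) : ℝ) ^ 2 / 4 * (4 * ((((F.P K).d - 1 : ℕ) : ℝ) * ((2 * (F.P K).L - 1 : ℕ) : ℝ)) + 1)) + 2 * ((((F.P K).d + 1) * ((F.P K).L - 1) : ℕ) : ℝ) * ((((14 * ((F.P K).d * (((F.P K).L - 1) / 2)) + 1 : ℕ) : ℝ)) * ((((F.P K).d - 1 : ℕ) : ℝ) * (((F.P K).L - 1 : ℕ) : ℝ)))) * a₁ +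
        2 * ((100 * (240 * ((((F.P K).d + 2) * (F.P K).L : ℕ) : ℝ) ^ 2 * (κ * ε' * ((F.P K).L : ℝ))) ^ 2 + 6 * ψ + 100 * (240 * ((((F.P K).d + 2) * (F.P K).L : ℕ) : ℝ) ^ 2 * (κ * ε' * ((F.P K).L : ℝ))) ^ 2 * (6 * ψ)) +
            (100 * (240 * ((((F.P K).d + 2) * (F.P K).L : ℕ) : ℝ) ^ 2 * (κ * ε' * ((F.P K).L : ℝ))) ^ 2 + 6 * ψ + 100 * (240 * ((((F.P K).d + 2) * (F.P K).L : ℕ) : ℝ) ^ 2 * (κ * ε' * ((F.P K).L : ℝ))) ^ 2 * (6 * ψ)) +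
            (100 * (240 * ((((F.P K).d + 2) * (F.P K).L : ℕ) : ℝ) ^ 2 * (κ * ε' * ((F.P K).L : ℝ))) ^ 2 + 6 * ψ + 100 * (240 * ((((F.P K).d + 2) * (F.P K).L : ℕ) : ℝ) ^ 2 * (κ * ε' * ((F.P K).L : ℝ))) ^ 2 * (6 * ψ)) *
              (100 * (240 * ((((F.P K).d + 2) * (F.P K).L : ℕ) : ℝ) ^ 2 * (κ * ε' * ((F.P K).L : ℝ))) ^ 2 + 6 * ψ + 100 * (240 * ((((F.P K).d + 2) * (F.P K).L : ℕ) : ℝ) ^ 2 * (κ * ε' * ((F.P K).L : ℝ))) ^ 2 * (6 * ψ))) ≤ 1 / 2)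
    -- the cell, in MODULE 77b's near class
    (c : BondIdx (domainsMeet (cubeDomains (F.P K) (cornerP (F.P K) Mc ρ idx) (sideP (F.P K) Mc ρ) ρ j hk) (domainsOfSeq s.Ω j hk)))
    (hnear : (c.1.1 : ℕ) = j ∨
      (blockOf c.1.2.src ∈ (cubeDomains (F.P K) (cornerP (F.P K) Mc ρ idx) (sideP (F.P K) Mc ρ) ρ j hk).Om ((c.1.1 : ℕ) + 1) ∧
        blockOf c.1.2.tgt ∈ (cubeDomains (F.P K) (cornerP (F.P K) Mc ρ idx) (sideP (F.P K) Mc ρ) ρ j hk).Om ((c.1.1 : ℕ) + 1))) :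
    ‖bondAvgIter (c.1.1 : ℕ) A c.1.2‖ ≤
      ((F.P K).L : ℝ) * (2 * (((((F.P K).d - 1 : ℕ) : ℝ) * ((crad (sideP (F.P K) Mc ρ) ρ : ℕ) : ℝ) * (1 + 2 * ((((F.P K).L : ℝ) ^ 2 + 6 * ((((F.P K).d + 2) * (F.P K).L : ℕ) : ℝ) ^ 2) * (4 * ((((F.P K).d - 1 : ℕ) : ℝ) * ((2 * (F.P K).L - 1 : ℕ) : ℝ)) + 1))) + 14 * (((((F.P K).d + 2) * (F.P K).L : ℕ) : ℝ) ^ 2 / 4 * (4 * ((((F.P K).d - 1 : ℕ) : ℝ) * ((2 * (F.P K).L - 1 : ℕ) : ℝ)) + 1)) + 2 * ((((F.P K).d + 1) * ((F.P K).L - 1) : ℕ) : ℝ) * ((((14 * ((F.P K).d * (((F.P K).L - 1) / 2)) + 1 : ℕ) : ℝ)) * ((((F.P K).d - 1 : ℕ) : ℝ) * (((F.P K).L - 1 : ℕ) : ℝ)))) * δ j +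
        ((100 * (240 * ((((F.P K).d + 2) * (F.P K).L : ℕ) : ℝ) ^ 2 * (κ * ε' * ((F.P K).L : ℝ))) ^ 2 + 6 * ψ + 100 * (240 * ((((F.P K).d + 2) * (F.P K).L : ℕ) : ℝ) ^ 2 * (κ * ε' * ((F.P K).L : ℝ))) ^ 2 * (6 * ψ)) +
            (100 * (240 * ((((F.P K).d + 2) * (F.P K).L : ℕ) : ℝ) ^ 2 * (κ * ε' * ((F.P K).L : ℝ))) ^ 2 + 6 * ψ + 100 * (240 * ((((F.P K).d + 2) * (F.P K).L : ℕ) : ℝ) ^ 2 * (κ * ε' * ((F.P K).L : ℝ))) ^ 2 * (6 * ψ)) +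
            (100 * (240 * ((((F.P K).d + 2) * (F.P K).L : ℕ) : ℝ) ^ 2 * (κ * ε' * ((F.P K).L : ℝ))) ^ 2 + 6 * ψ + 100 * (240 * ((((F.P K).d + 2) * (F.P K).L : ℕ) : ℝ) ^ 2 * (κ * ε' * ((F.P K).L : ℝ))) ^ 2 * (6 * ψ)) *
              (100 * (240 * ((((F.P K).d + 2) * (F.P K).L : ℕ) : ℝ) ^ 2 * (κ * ε' * ((F.P K).L : ℝ))) ^ 2 + 6 * ψ + 100 * (240 * ((((F.P K).d + 2) * (F.P K).L : ℕ) : ℝ) ^ 2 * (κ * ε' * ((F.P K).L : ℝ))) ^ 2 * (6 * ψ))) * (1 + ((((F.P K).d - 1 : ℕ) : ℝ) * ((crad (sideP (F.P K) Mc ρ) ρ : ℕ) : ℝ) * (1 + 2 * ((((F.P K).L : ℝ) ^ 2 + 6 * ((((F.P K).d + 2) * (F.P K).L : ℕ) : ℝ) ^ 2) * (4 * ((((F.P K).d - 1 : ℕ) : ℝ) * ((2 * (F.P K).L - 1 : ℕ) : ℝ)) + 1))) + 14 * (((((F.P K).d + 2) * (F.P K).L : ℕ) : ℝ) ^ 2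 / 4 * (4 * ((((F.P K).d - 1 : ℕ) : ℝ) * ((2 * (F.P K).L - 1 : ℕ) : ℝ)) + 1)) + 2 * ((((F.P K).d + 1) * ((F.P K).L - 1) : ℕ) : ℝ) * ((((14 * ((F.P K).d * (((F.P K).L - 1) / 2)) + 1 : ℕ) : ℝ)) * ((((F.P K).d - 1 : ℕ) : ℝ) * (((F.P K).L - 1 : ℕ) : ℝ)))) * δ j)) +
        64 * 60800 * ((((F.P K).d + 2) * (F.P K).L : ℕ) : ℝ) ^ 2 * (κ * ε' * ((F.P K).L : ℝ)) ^ 2) := by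
  -- write `j = m + 1`
  obtain ⟨m, rfl⟩ : ∃ m, j = m + 1 := ⟨j - 1, by omega⟩
  -- ### opaque atoms: the within-block coefficient (an `ℕ`-division), `X₀′` and `Ω`
  obtain ⟨kc, hkc⟩ : ∃ kc : ℝ, kc = (((14 * ((F.P K).d * (((F.P K).L - 1) / 2)) + 1 : ℕ) : ℝ)) := ⟨_, rfl⟩
  rw [← hkc] at hX ⊢
  obtain ⟨Ω, hΩdef⟩ : ∃ Ω : ℝ, Ω = ((100 * (240 * ((((F.P K).d + 2) * (F.P K).L : ℕ) : ℝ) ^ 2 * (κ * ε' * ((F.P K).L : ℝ))) ^ 2 + 6 * ψ + 100 * (240 * ((((F.P K).d + 2) * (F.P K).L : ℕ) : ℝ) ^ 2 * (κ * ε' * ((F.P K).L : ℝ))) ^ 2 * (6 * ψ)) +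
            (100 * (240 * ((((F.P K).d + 2) * (F.P K).L : ℕ) : ℝ) ^ 2 * (κ * ε' * ((F.P K).L : ℝ))) ^ 2 + 6 * ψ + 100 * (240 * ((((F.P K).d + 2) * (F.P K).L : ℕ) : ℝ) ^ 2 * (κ * ε' * ((F.P K).L : ℝ))) ^ 2 * (6 * ψ)) +
            (100 * (240 * ((((F.P K).d + 2) * (F.P K).L : ℕ) : ℝ) ^ 2 * (κ * ε' * ((F.P K).L : ℝ))) ^ 2 + 6 * ψ + 100 * (240 * ((((F.P K).d + 2) * (F.P K).L : ℕ) : ℝ) ^ 2 * (κ * ε' * ((F.P K).L : ℝ))) ^ 2 * (6 * ψ)) *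
              (100 * (240 * ((((F.P K).d + 2) * (F.P K).L : ℕ) : ℝ) ^ 2 * (κ * ε' * ((F.P K).L : ℝ))) ^ 2 + 6 * ψ + 100 * (240 * ((((F.P K).d + 2) * (F.P K).L : ℕ) : ℝ) ^ 2 * (κ * ε' * ((F.P K).L : ℝ))) ^ 2 * (6 * ψ))) := ⟨_, rfl⟩
  rw [← hΩdef] at hX ⊢
  obtain ⟨X0, hX0def⟩ : ∃ X0 : ℝ, X0 = ((((F.P K).d - 1 : ℕ) : ℝ) * ((crad (sideP (F.P K) Mc ρ) ρ : ℕ) : ℝ) * (1 + 2 * ((((F.P K).L : ℝ) ^ 2 + 6 * ((((F.P K).d + 2) * (F.P K).L : ℕ) : ℝ) ^ 2) * (4 * ((((F.P K).d - 1 : ℕ) : ℝ) * ((2 * (F.P K).L - 1 : ℕ) : ℝ)) + 1))) + 14 * (((((F.P K).d + 2) * (F.P K).L : ℕ) : ℝ) ^ 2 / 4 * (4 * ((((F.P K).d - 1 : ℕ) : ℝ) * ((2 * (F.P K).L - 1 : ℕ) : ℝ)) + 1)) + 2 * ((((F.P K).d + 1) * ((F.P K).L - 1) : ℕ) : ℝ)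 * (kc * ((((F.P K).d - 1 : ℕ) : ℝ) * (((F.P K).L - 1 : ℕ) : ℝ)))) := ⟨_, rfl⟩
  rw [← hX0def] at hX ⊢
  -- ### letters and signs
  have hℓ0 : (0 : ℝ) ≤ ((((F.P K).d + 2) * (F.P K).L : ℕ) : ℝ) := Nat.cast_nonneg _
  have hCL0 : (0 : ℝ) ≤ 1 + 2 * ((((F.P K).L : ℝ) ^ 2 + 6 * ((((F.P K).d + 2) * (F.P K).L : ℕ) : ℝ) ^ 2) *
      (4 * (((((F.P K).d - 1 : ℕ) : ℝ)) * ((2 * (F.P K).L - 1 : ℕ) : ℝ)) + 1)) := by positivity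
  have hR0 : (0 : ℝ) ≤ (((F.P K).d - 1 : ℕ) : ℝ) * ((crad (sideP (F.P K) Mc ρ) ρ : ℕ) : ℝ) * (1 + 2 * ((((F.P K).L : ℝ) ^ 2 + 6 * ((((F.P K).d + 2) * (F.P K).L : ℕ) : ℝ) ^ 2) * (4 * ((((F.P K).d - 1 : ℕ) : ℝ) * ((2 * (F.P K).L - 1 : ℕ) : ℝ)) + 1))) := by positivity
  have hkc0 : (0 : ℝ) ≤ kc := by rw [hkc]; exact Nat.cast_nonneg _
  have hΨ0 : (0 : ℝ) ≤ kc * ((((F.P K).d - 1 : ℕ) : ℝ) * (((F.P K).L - 1 : ℕ) : ℝ)) := mul_nonneg hkc0 (by positivity)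
  have hT0 : (0 : ℝ) ≤ (((((F.P K).d + 2) * (F.P K).L : ℕ) : ℝ) ^ 2 / 4 * (4 * ((((F.P K).d - 1 : ℕ) : ℝ) * ((2 * (F.P K).L - 1 : ℕ) : ℝ)) + 1)) := by positivity
  have hD0 : (0 : ℝ) ≤ ((((F.P K).d + 1) * ((F.P K).L - 1) : ℕ) : ℝ) := by positivity
  have hDΨ0 : (0 : ℝ) ≤ 2 * ((((F.P K).d + 1) * ((F.P K).L - 1) : ℕ) : ℝ) * (kc * ((((F.P K).d - 1 : ℕ) : ℝ) * (((F.P K).L - 1 : ℕ) : ℝ))) := mul_nonneg (mul_nonneg (by norm_num) hD0) hΨ0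
  have hX00 : 0 ≤ X0 := by rw [hX0def]; linarith only [hR0, hT0, hDΨ0]
  have hφ0 : (0 : ℝ) ≤ 100 * (240 * ((((F.P K).d + 2) * (F.P K).L : ℕ) : ℝ) ^ 2 * (κ * ε' * ((F.P K).L : ℝ))) ^ 2 := by positivity
  have hω0 : (0 : ℝ) ≤ (100 * (240 * ((((F.P K).d + 2) * (F.P K).L : ℕ) : ℝ) ^ 2 * (κ * ε' * ((F.P K).L : ℝ))) ^ 2 + 6 * ψ + 100 * (240 * ((((F.P K).d + 2) * (F.P K).L : ℕ) : ℝ) ^ 2 * (κ * ε' * ((F.P K).L : ℝ))) ^ 2 * (6 * ψ)) := by positivity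
  have hΩ0 : 0 ≤ Ω := by rw [hΩdef]; positivity
  have hδj : 0 < δ (m + 1) := (hδ (m + 1) hjk).1
  have hδm : 0 < δ m := (hδ m (by omega)).1
  have hδja : δ (m + 1) ≤ a₁ := (hδ (m + 1) hjk).2
  have hcomp : δ m ≤ 2 * δ (m + 1) := hcompδ m (by omega)
  have hsA0 : 0 ≤ κ * ε' * ((F.P K).L : ℝ) := by positivity
  -- the range: `Y := X0·δ_j + Ω(1 + X0·δ_j) ≤ ½`
  have hXδ : X0 * δ (m + 1) ≤ X0 * a₁ := mul_le_mul_of_nonneg_left hδja hX00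
  have hXa : X0 * a₁ ≤ 1 / 2 := by linarith only [hX, hΩ0]
  have hY : X0 * δ (m + 1) + Ω * (1 + X0 * δ (m + 1)) ≤ 1 / 2 := by
    have h2 : Ω * (1 + X0 * δ (m + 1)) ≤ Ω * 2 := mul_le_mul_of_nonneg_left (by linarith only [hXδ, hXa]) hΩ0
    linarith only [hX, hXδ, h2]
  -- ### the accumulated double-bar frames of the Landau copy (the recursion's own family)
  let V : (i : ℕ) → Site (F.P K) i → (Matrix (Fin N) (Fin N) ℂ)ˣ := fun i =>
    Nat.rec (motive := fun i => Site (F.P K) i → (Matrix (Fin N) (Fin N) ℂ)ˣ) (fun _ => 1)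
      (fun i Vi y => Vi (emb y) * vframeU (dbarIterU i (unitsField (toUField (gaugeAct u U)))) y) i
  have hV0 : ∀ x, V 0 x = 1 := fun _ => rfl
  have hVs : ∀ (i : ℕ) (y : Site (F.P K) (i + 1)), V (i + 1) y = V i (emb y) * vframeU (dbarIterU i (unitsField (toUField (gaugeAct u U)))) y :=
    fun _ _ => rfl
  -- ### MODULE 79's split of the near class
  have hν1 : 1 ≤ ν.M₁ := by omega
  have hfl : 11 * (F.P K).d + 2 * ρ + Mc + 3 + 2 * ρ ≤ ν.M₁ := by
    have hL1 : 1 ≤ (F.P K).L := (F.P K).L_pos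
    have : 11 * (F.P K).d + 4 * ρ + Mc ≤ (11 * (F.P K).d + 4 * ρ + Mc) * (F.P K).L := Nat.le_mul_of_pos_right _ hL1
    omega
  obtain ⟨x₀, hx₀, y₀, hy₀, hxy₀⟩ := hmeet
  have hcases := near_cases_meet_both (P := F.P K) hν1 s hsep hρ hfl (by omega : 1 ≤ m + 1) hjk hk hx₀ hy₀ hxy₀ c
  -- η, s and the UST budget
  have hη : 0 < (F.P K).eta (m + 1) := by
    unfold Params.eta
    exact pow_pos (inv_pos.mpr (by exact_mod_cast (F.P K).L_pos)) _
  have hLη : ((F.P K).L : ℝ) ^ (m + 1) * (F.P K).eta (m + 1) = 1 := B12Eq115BackgroundPair.pow_mul_eta (F.P K) (m + 1)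
  have hL1 : (1 : ℝ) ≤ (F.P K).L := by exact_mod_cast (F.P K).L_pos
  have hpow1 : (m + 1) - (m + 1 - 1) = 1 := by omega
  -- destructure the cell
  obtain ⟨⟨⟨l, hl⟩, b⟩, hb⟩ := c
  simp only at hnear hcases hb ⊢
  rcases hcases with htop | ⟨hlev, hs, -, hns, hnt⟩ | hfar
  · -- ##### TOP bond
    subst htop
    have hrow := norm_dbar_sub_one_top_le_symPhi F N s hsep hkK hgrid hMc hρ hLρ hfloor hδ hcompδ hguard W h7 U hfib hjk hjK idx ⟨x₀, hx₀, y₀, hy₀, hxy₀⟩ hclean hn hnN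
      u A hκ hε' hT1 hT2 hgd hσF hσS hσ4 hk hψ0 hψ hN hAdm hRM V hV0 hVs b hb
    rw [← hΩdef] at hrow
    have hr : (((F.P K).d - 1 : ℕ) : ℝ) * ((crad (sideP (F.P K) Mc ρ) ρ : ℕ) : ℝ) * (1 + 2 * ((((F.P K).L : ℝ) ^ 2 + 6 * ((((F.P K).d + 2) * (F.P K).L : ℕ) : ℝ) ^ 2) * (4 * ((((F.P K).d - 1 : ℕ) : ℝ) * ((2 * (F.P K).L - 1 : ℕ) : ℝ)) + 1))) * δ (m + 1) ≤ X0 * δ (m + 1) := by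
      refine mul_le_mul_of_nonneg_right ?_ hδj.le
      rw [hX0def]; linarith only [hT0, hDΨ0]
    have hXb : ‖((dbarIterU (m + 1) (unitsField (toUField (gaugeAct u U))) b : (MatA N)ˣ) : MatA N) - 1‖ ≤ X0 * δ (m + 1) + Ω * (1 + X0 * δ (m + 1)) := by
      refine hrow.trans (le_trans (le_of_eq ?_) (row_mono hr hΩ0))
      ring
    have hm := norm_mlog_le_two_mul_of_le hXb hY
    -- labels and reads of `b`
    obtain ⟨sl, sl', hsrc, htgt, hsl, hsl'⟩ := exists_collar_labels_of_lamBond_meet (domainsOfSeq s.Ω (m + 1) hk) (by omega : 1 ≤ m + 1) le_rfl hb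
    have hreads : ∀ b₀ : PBond (F.P K) 0, (iterBlockOf (m + 1) b₀.src = b.src ∨ iterBlockOf (m + 1) b₀.src = b.tgt) →
        (iterBlockOf (m + 1) b₀.tgt = b.src ∨ iterBlockOf (m + 1) b₀.tgt = b.tgt) →
        unitsField (toUField (gaugeAct u U)) b₀ = expCfg ((F.P K).eta (m + 1)) A b₀ ∧ ‖A b₀‖ ≤ κ * ε' * ((F.P K).L : ℝ) := by
      intro b₀ hbs hbt
      rw [hsrc, htgt] at hbs hbt
      obtain ⟨h1, h2, -⟩ := landau_reads_of_tower (k := m + 1) hk hLρ (by omega) le_rfl U u A hη.le hT1 hT2 hsl hsl' b₀ hbs hbt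
      rw [hpow1, pow_one] at h2
      exact ⟨h1, h2.le⟩
    have hbudget : 243200 * ((((F.P K).d + 2) * (F.P K).L : ℕ) : ℝ) ^ 2 * ((F.P K).L : ℝ) ^ (m + 1) * (F.P K).eta (m + 1) * (κ * ε' * ((F.P K).L : ℝ)) ≤ 1 := by
      have e : 243200 * ((((F.P K).d + 2) * (F.P K).L : ℕ) : ℝ) ^ 2 * ((F.P K).L : ℝ) ^ (m + 1) * (F.P K).eta (m + 1) * (κ * ε' * ((F.P K).L : ℝ)) =
          243200 * ((((F.P K).d + 2) * (F.P K).L : ℕ) : ℝ) ^ 2 * (κ * ε' * ((F.P K).L : ℝ)) * (((F.P K).L : ℝ) ^ (m + 1) * (F.P K).eta (m + 1)) := by ring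
      rw [e, hLη, mul_one]; exact hbud
    have hQ := norm_bondAvgIter_le_of_dbar_reads ((F.P K).eta (m + 1)) hη hk b A hsA0 hbudget (fun b₀ h1 h2 => (hreads b₀ h1 h2).2) _
      (fun b₀ h1 h2 => (hreads b₀ h1 h2).1) hm
    refine hQ.trans ?_
    exact div_weight_le (by positivity) (by positivity) hη (by positivity) le_rfl hL1 (by rw [mul_one, mul_comm]; exact hLη)
  · -- ##### DENT pair at level `m`
    have hlm : l = m := by omega
    subst hlm
    have hrow := norm_dbar_sub_one_dent_le_symPhi F N s hsep hkK hgrid hMc hρ hLρ hfloor hδ hcompδ hguard hguardF W h7 U hfib hjk hjK idx ⟨x₀, hx₀, y₀, hy₀, hxy₀⟩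
      hclean hn hnN u A hκ hε' hT1 hT2 hgd hσF hσS hσ4 hk hψ0 hψ hN hAdm hRM V hV0 hVs b hb hs hns hnt
    rw [← hkc, ← hΩdef] at hrow
    have hlin := dent_row_le_linear (R := (((F.P K).d - 1 : ℕ) : ℝ) * ((crad (sideP (F.P K) Mc ρ) ρ : ℕ) : ℝ) * (1 + 2 * ((((F.P K).L : ℝ) ^ 2 + 6 * ((((F.P K).d + 2) * (F.P K).L : ℕ) : ℝ) ^ 2) * (4 * ((((F.P K).d - 1 : ℕ) : ℝ) * ((2 * (F.P K).L - 1 : ℕ) : ℝ)) + 1)))) (T := (((((F.P K).d + 2) * (F.P K).L : ℕ) : ℝ) ^ 2 / 4 * (4 * ((((F.P K).d - 1 : ℕ) : ℝ) * ((2 * (F.P K).L - 1 : ℕ) : ℝ)) + 1))) (D := ((((F.P K).d + 1) * ((F.P K).L - 1) : ℕ) : ℝ))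
      (Ψ := kc * ((((F.P K).d - 1 : ℕ) : ℝ) * (((F.P K).L - 1 : ℕ) : ℝ))) (δj := δ (l + 1)) hT0 hD0 hΨ0 hcomp
    rw [← hX0def] at hlin
    have hXb : ‖((dbarIterU l (unitsField (toUField (gaugeAct u U))) b : (MatA N)ˣ) : MatA N) - 1‖ ≤ X0 * δ (l + 1) + Ω * (1 + X0 * δ (l + 1)) := by
      refine hrow.trans ?_
      refine row_mono (le_trans (le_of_eq ?_) hlin) hΩ0
      ring
    have hm := norm_mlog_le_two_mul_of_le hXb hY
    -- labels of the two blocks (top cube) and reads of `b`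
    obtain ⟨t, htbox, htb⟩ := (mem_cubeDomains_Om_iff (by omega) le_rfl _).1 hs
    have hsrc : blockOf b.src = (castSite t : Site (F.P K) (l + 1)) := htb.symm
    have htI : t ∈ Set.Icc (sqLo (F.P K).L (cornerP (F.P K) Mc ρ idx) ρ (l + 1) (l + 1) - 1)
        (sqHi (F.P K).L (cornerP (F.P K) Mc ρ idx) (sideP (F.P K) Mc ρ) ρ (l + 1) (l + 1) + 1) := Icc_collar_of_inBox htbox
    have htμI : t + e b.dir ∈ Set.Icc (sqLo (F.P K).L (cornerP (F.P K) Mc ρ idx) ρ (l + 1) (l + 1) - 1)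
        (sqHi (F.P K).L (cornerP (F.P K) Mc ρ idx) (sideP (F.P K) Mc ρ) ρ (l + 1) (l + 1) + 1) := Icc_collar_add_e_of_inBox htbox b.dir
    have htgt2 : ∃ t₂ : Pt (F.P K).d, (t₂ = t ∨ t₂ = t + e b.dir) ∧ blockOf b.tgt = (castSite t₂ : Site (F.P K) (l + 1)) := by
      rcases blockOf_shift_or hk b.src b.dir with hsame | hshift
      · exact ⟨t, Or.inl rfl, by rw [PBond.tgt, hsame, hsrc]⟩
      · exact ⟨t + e b.dir, Or.inr rfl, by rw [PBond.tgt, hshift, hsrc, castSite_add_e]⟩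
    obtain ⟨t₂, ht₂, htgt⟩ := htgt2
    have ht₂I : t₂ ∈ Set.Icc (sqLo (F.P K).L (cornerP (F.P K) Mc ρ idx) ρ (l + 1) (l + 1) - 1)
        (sqHi (F.P K).L (cornerP (F.P K) Mc ρ idx) (sideP (F.P K) Mc ρ) ρ (l + 1) (l + 1) + 1) := by
      rcases ht₂ with h1 | h1 <;> rw [h1]
      · exact htI
      · exact htμI
    have hIb : ∀ {z : Pt (F.P K).d}, z ∈ Set.Icc (sqLo (F.P K).L (cornerP (F.P K) Mc ρ idx) ρ (l + 1) (l + 1) - 1)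
        (sqHi (F.P K).L (cornerP (F.P K) Mc ρ idx) (sideP (F.P K) Mc ρ) ρ (l + 1) (l + 1) + 1) →
        InBox (sqLo (F.P K).L (cornerP (F.P K) Mc ρ idx) ρ (l + 1) (l + 1) - 1) (sqHi (F.P K).L (cornerP (F.P K) Mc ρ idx) (sideP (F.P K) Mc ρ) ρ (l + 1) (l + 1) + 1) z :=
      fun hz i => ⟨hz.1 i, hz.2 i⟩
    have hreads : ∀ b₀ : PBond (F.P K) 0, (iterBlockOf l b₀.src = b.src ∨ iterBlockOf l b₀.src = b.tgt) →
        (iterBlockOf l b₀.tgt = b.src ∨ iterBlockOf l b₀.tgt = b.tgt) →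
        unitsField (toUField (gaugeAct u U)) b₀ = expCfg ((F.P K).eta (l + 1)) A b₀ ∧ ‖A b₀‖ ≤ κ * ε' * ((F.P K).L : ℝ) := by
      intro b₀ hbs hbt
      have hup : ∀ x : Site (F.P K) 0, (iterBlockOf l x = b.src ∨ iterBlockOf l x = b.tgt) →
          (iterBlockOf (l + 1) x = coverAt (F.P K) (l + 1) t ∨ iterBlockOf (l + 1) x = coverAt (F.P K) (l + 1) t₂) := by
        intro x hx
        rw [iterBlockOf_succ]
        rcases hx with h1 | h1
        · left; rw [h1, hsrc]; rfl
        · right; rw [h1, htgt]; rfl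
      obtain ⟨h1, h2, -⟩ := landau_reads_of_tower (k := l + 1) hk hLρ (by omega) le_rfl U u A hη.le hT1 hT2 (hIb htI) (hIb ht₂I) b₀ (hup _ hbs) (hup _ hbt)
      rw [hpow1, pow_one] at h2
      exact ⟨h1, h2.le⟩
    have hLm : ((F.P K).L : ℝ) ^ l * (F.P K).eta (l + 1) * ((F.P K).L : ℝ) = 1 := by
      rw [← hLη]; ring
    have hbudget : 243200 * ((((F.P K).d + 2) * (F.P K).L : ℕ) : ℝ) ^ 2 * ((F.P K).L : ℝ) ^ l * (F.P K).eta (l + 1) * (κ * ε' * ((F.P K).L : ℝ)) ≤ 1 := by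
      have hle : ((F.P K).L : ℝ) ^ l * (F.P K).eta (l + 1) ≤ 1 := by
        have h0 : 0 ≤ ((F.P K).L : ℝ) ^ l * (F.P K).eta (l + 1) := by positivity
        have h1 : ((F.P K).L : ℝ) ^ l * (F.P K).eta (l + 1) ≤ ((F.P K).L : ℝ) ^ l * (F.P K).eta (l + 1) * ((F.P K).L : ℝ) :=
          le_mul_of_one_le_right h0 hL1
        rw [hLm] at h1; exact h1
      have e : 243200 * ((((F.P K).d + 2) * (F.P K).L : ℕ) : ℝ) ^ 2 * ((F.P K).L : ℝ) ^ l * (F.P K).eta (l + 1) * (κ * ε' * ((F.P K).L : ℝ)) =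
          243200 * ((((F.P K).d + 2) * (F.P K).L : ℕ) : ℝ) ^ 2 * (κ * ε' * ((F.P K).L : ℝ)) * (((F.P K).L : ℝ) ^ l * (F.P K).eta (l + 1)) := by ring
      rw [e]
      have h0 : 0 ≤ 243200 * ((((F.P K).d + 2) * (F.P K).L : ℕ) : ℝ) ^ 2 * (κ * ε' * ((F.P K).L : ℝ)) := by positivity
      exact (mul_le_of_le_one_right h0 hle).trans hbud
    have hQ := norm_bondAvgIter_le_of_dbar_reads ((F.P K).eta (l + 1)) hη (Nat.le_of_succ_le hk) b A hsA0 hbudget (fun b₀ h1 h2 => (hreads b₀ h1 h2).2) _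
      (fun b₀ h1 h2 => (hreads b₀ h1 h2).1) hm
    refine hQ.trans ?_
    exact div_weight_le (by positivity) (by positivity) hη (by positivity) hL1 le_rfl (by rw [mul_comm ((F.P K).eta (l + 1)), hLm])
  · exact absurd hnear hfar

end Record

end Summit.QuantumFields.YangMills.BalabanUVNodes.N07SymNearRowsQAPhi

end
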